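import Summits.MatrixMultiplication.MatrixMultiplication.Theses.ToricBorderRank

/-!
# Route ToricBorderRank · support `SchonhageToric` — Schönhage's `τ`-example is toric

Item `stmt-MatrixMultiplication-9967` of route `route-MatrixMultiplication-ToricBorderRank`:
for `e, l ≥ 2` the direct sum `⟨e,1,l⟩ ⊕ ⟨1,(e-1)(l-1),1⟩`
(`matMulDirectSum ℂ ![e,1] ![1,(e-1)(l-1)] ![l,1]`) has a TORIC PARENT of honest rank `≤ e l + 1`:
integer weights `α, β, γ` on the three index sets vanishing on the support (W0) and an honest tensor
`T` of rank `≤ e l + 1` agreeing with the direct sum on every cell of weight `≤ 0` (W1).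

## The witness (Schönhage 1981; Bürgisser–Clausen–Shokrollahi 1997, (15.12); Bläser 2013, Lemma 7.1)

Write `e = e' + 1`, `l = l' + 1`, `h = e' l'`. Block `0` of the direct sum is
`∑_{i<e, j<l} z_{ij} ⊗ a_i ⊗ b_j` (outer product), block `1` is `∑_{μ<h} w ⊗ u_μ ⊗ v_μ`
(inner product). Schönhage's approximate algorithm with `ε := 1` is the honest rank-`(el+1)` tensor
`T = ∑_{i<e, j<l} (z_{ij} + w) ⊗ (a_i + u_{ij}) ⊗ (b_j + v_{ij}) - w ⊗ (∑ a_i) ⊗ (∑ b_j)`, where,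
with `μ ↔ (μ / l', μ % l') ∈ [e'] × [l']`, `u_{ij} = e_{(i,j)}` for `i < e', j < l'`,
`u_{e' j} = -∑_{i<e'} e_{(i,j)}`, `u_{i l'} = 0`, and symmetrically `v_{ij} = e_{(i,j)}`,
`v_{i l'} = -∑_{j<l'} e_{(i,j)}`, `v_{e' j} = 0`; so `∑_i u_{ij} = 0`, `∑_j v_{ij} = 0` and
`∑_{ij} u_{ij} ⊗ v_{ij} = ∑_μ e_μ ⊗ e_μ`. Weights: `0` on `z, a, b`, `-2` on `w`, `1` on `u, v`.
The cells of weight `≤ 0` are the block triples `(0,0,0), (1,0,0), (1,1,0), (1,0,1), (1,1,1)`, on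
which `T` evaluates to `⟨e,1,l⟩`, `1 - 1 = 0`, `∑_i u_{ij} = 0`, `∑_j v_{ij} = 0`, `δ_{μν}`
respectively — the degree-`0` and degree-`1` parts of BCS (15.12) cancel identically.

Everything is stated on the literal index types of the route declaration
(`Σ i : Fin 2, Fin (![e,1] i) × Fin (![l,1] i)` etc.); all vectors are written through the `ℕ`-values
of the coordinates, exactly as `matMulDirectSum` is.
-/

open scoped BigOperators
open Literature.Computability.AlgebraicComplexity

-- single-conjunct summit: the `Summit.<S>.<P>` prefix repeats `MatrixMultiplication` by design (D-0017)
set_option linter.dupNamespace false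

namespace Summit.MatrixMultiplication.MatrixMultiplication.Theorems

/-- Indicator sums over `Fin n` written through `ℕ`-values: `∑_{i : Fin n} [x = i] g i = g x` for
`x < n`. -/
theorem schonhageToric_sum_fin_ite_eq_val {M : Type*} [AddCommMonoid M] {n x : ℕ} (hx : x < n)
    (g : Fin n → M) : ∑ i : Fin n, (if x = (i : ℕ) then g i else 0) = g ⟨x, hx⟩ := by
  rw [Fintype.sum_eq_single (⟨x, hx⟩ : Fin n) (fun i hi => if_neg fun h => hi (Fin.ext h.symm)),
    if_pos rfl]

/-- Schönhage's correction vectors `u_{ij}`, `v_{ij}` in coordinates (`U i j μ` = the `μ`-th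
coordinate of `u_{ij}`, `V i j ν` = the `ν`-th coordinate of `v_{ij}`, block `1` coordinates
`μ < e' l'` read as pairs `(μ / l', μ % l')`), with the three identities the toric witness needs:
column sums of `u` vanish, row sums of `v` vanish, and `∑_{ij} u_{ij} ⊗ v_{ij}` is the identity
(Bläser 2013, proof of Lemma 7.1; BCS 1997, (15.12)). -/
theorem schonhageToric_exists_coeffs (e' l' : ℕ) :
    ∃ U V : ℕ → ℕ → ℕ → ℂ,
      (∀ j μ, μ < e' * l' → ∑ i : Fin (e' + 1), U i j μ = 0) ∧
      (∀ i ν, ν < e' * l' → ∑ j : Fin (l' + 1), V i j ν = 0) ∧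
      (∀ μ ν, μ < e' * l' → ν < e' * l' →
        ∑ i : Fin (e' + 1), ∑ j : Fin (l' + 1), U i j μ * V i j ν = if μ = ν then 1 else 0) := by
  have hdiv : ∀ {μ}, μ < e' * l' → μ / l' < e' ∧ μ % l' < l' := by
    intro μ hμ
    have hl : 0 < l' := Nat.pos_of_ne_zero (by rintro rfl; simp at hμ)
    exact ⟨(Nat.div_lt_iff_lt_mul hl).2 hμ, Nat.mod_lt _ hl⟩
  have hne : ∀ i : Fin e', ((i : ℕ) = e') = False := fun i => eq_false (Nat.ne_of_lt i.2)
  have hnej : ∀ j : Fin l', ((j : ℕ) = l') = False := fun j => eq_false (Nat.ne_of_lt j.2)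
  refine ⟨fun i j μ => if j = l' then 0 else if i = e' then (if μ % l' = j then -1 else 0)
      else (if μ / l' = i ∧ μ % l' = j then 1 else 0),
    fun i j ν => if i = e' then 0 else if j = l' then (if ν / l' = i then -1 else 0)
      else (if ν / l' = i ∧ ν % l' = j then 1 else 0), ?_, ?_, ?_⟩
  · intro j μ hμ
    obtain ⟨hd, -⟩ := hdiv hμ
    by_cases hj : j = l'
    · simp [hj]
    rw [Fin.sum_univ_castSucc]
    simp only [Fin.val_castSucc, Fin.val_last, hj, hne, if_false, if_true]
    by_cases hq : μ % l' = j
    · simp only [hq, and_true, if_true, schonhageToric_sum_fin_ite_eq_val hd]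
      ring
    · simp [hq]
  · intro i ν hν
    obtain ⟨-, hm⟩ := hdiv hν
    by_cases hi : i = e'
    · simp [hi]
    rw [Fin.sum_univ_castSucc]
    simp only [Fin.val_castSucc, Fin.val_last, hi, hnej, if_false, if_true]
    by_cases hq : ν / l' = i
    · simp only [hq, true_and, if_true, schonhageToric_sum_fin_ite_eq_val hm]
      ring
    · simp [hq]
  · intro μ ν hμ hν
    obtain ⟨hd, hm⟩ := hdiv hμ
    rw [Fin.sum_univ_castSucc]
    simp only [Fin.sum_univ_castSucc (n := l'), Fin.val_castSucc, Fin.val_last, hne, hnej,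
      if_false, if_true, zero_mul, mul_zero, add_zero, Finset.sum_const_zero]
    rw [Fintype.sum_eq_single (⟨μ / l', hd⟩ : Fin e')]
    · rw [Fintype.sum_eq_single (⟨μ % l', hm⟩ : Fin l')]
      · by_cases h : μ = ν
        · subst h
          simp
        · have h' : ¬ (ν / l' = μ / l' ∧ ν % l' = μ % l') := by
            rintro ⟨h1, h2⟩
            exact h (by rw [← Nat.div_add_mod μ l', ← Nat.div_add_mod ν l', h1, h2])
          simp [h, h']
      · intro j hj
        have hj' : μ % l' ≠ (j : ℕ) := fun h => hj (Fin.ext h.symm)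
        simp [hj']
    · intro i hi
      have hi' : μ / l' ≠ (i : ℕ) := fun h => hi (Fin.ext h.symm)
      simp [hi']

/-- **Schönhage's `τ`-example is toric** (route ToricBorderRank, support item `SchonhageToric`,
card P2): for `e, l ≥ 2` the direct sum `⟨e,1,l⟩ ⊕ ⟨1,(e-1)(l-1),1⟩` has a toric parent of honest
rank `≤ e l + 1` — weights `0` on block `0` of each index set, `-2` on block `1` of the first index
set and `1` on block `1` of the other two, and `T` = Schönhage's approximate algorithm
(BCS 1997, (15.12); Bläser 2013, Lemma 7.1) with `ε := 1`. -/
theorem schonhageToric_proof :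
    Summit.MatrixMultiplication.MatrixMultiplication.Theses.ToricBorderRank.SchonhageToric := by
  intro e l he hl
  obtain ⟨e', rfl⟩ : ∃ e', e = e' + 1 := ⟨e - 1, by omega⟩
  obtain ⟨l', rfl⟩ : ∃ l', l = l' + 1 := ⟨l - 1, by omega⟩
  obtain ⟨U, V, hS1, hS2, hS3⟩ := schonhageToric_exists_coeffs e' l'
  refine ⟨fun a => if (a.1 : ℕ) = 0 then 0 else -2, fun b => if (b.1 : ℕ) = 0 then 0 else 1,
    fun c => if (c.1 : ℕ) = 0 then 0 else 1,
    ∑ s : Option (Fin (e' + 1) × Fin (l' + 1)),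
      triad
        (s.elim (fun a => if (a.1 : ℕ) = 0 then 0 else -1)
          (fun p a => if (a.1 : ℕ) = 0 then
            (if (a.2.1 : ℕ) = (p.1 : ℕ) then (if (a.2.2 : ℕ) = (p.2 : ℕ) then 1 else 0) else 0)
            else 1))
        (s.elim (fun b => if (b.1 : ℕ) = 0 then 1 else 0)
          (fun p b => if (b.1 : ℕ) = 0 then (if (b.2.1 : ℕ) = (p.1 : ℕ) then 1 else 0)
            else U p.1 p.2 b.2.2))
        (s.elim (fun c => if (c.1 : ℕ) = 0 then 1 else 0)
          (fun p c => if (c.1 : ℕ) = 0 then (if (c.2.2 : ℕ) = (p.2 : ℕ) then 1 else 0)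
            else V p.1 p.2 c.2.1)),
    ?_, ?_, ?_⟩
  · -- (W0): the weights vanish on the support of the direct sum
    rintro ⟨⟨_ | _ | ka, hka⟩, ⟨xa, hxa⟩, ⟨ya, hya⟩⟩ ⟨⟨_ | _ | kb, hkb⟩, ⟨xb, hxb⟩, ⟨yb, hyb⟩⟩
      ⟨⟨_ | _ | kc, hkc⟩, ⟨xc, hxc⟩, ⟨yc, hyc⟩⟩ hM
    any_goals omega
    all_goals simp [matMulDirectSum] at hM ⊢
  · -- (W1): `T` agrees with the direct sum on cells of weight `≤ 0`
    rintro ⟨⟨_ | _ | ka, hka⟩, ⟨xa, hxa⟩, ⟨ya, hya⟩⟩ ⟨⟨_ | _ | kb, hkb⟩, ⟨xb, hxb⟩, ⟨yb, hyb⟩⟩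
      ⟨⟨_ | _ | kc, hkc⟩, ⟨xc, hxc⟩, ⟨yc, hyc⟩⟩ hwt
    any_goals omega
    all_goals simp at hxa hya hxb hyb hxc hyc hwt
    · -- blocks (0,0,0): `T = ∑_{ij} [a = z_{ij}] [b = a_i] [c = b_j] = ⟨e,1,l⟩`
      subst hyb hxc
      simp only [Finset.sum_apply, triad_apply, Fintype.sum_option, Fintype.sum_prod_type,
        Option.elim_none, Option.elim_some]
      rw [Fintype.sum_eq_single (⟨xa, Nat.lt_succ_of_le hxa⟩ : Fin (e' + 1))]
      · rw [Fintype.sum_eq_single (⟨ya, Nat.lt_succ_of_le hya⟩ : Fin (l' + 1))]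
        · by_cases h1 : xa = xb <;> by_cases h2 : ya = yc
          · subst h1 h2
            simp [matMulDirectSum]
          · subst h1
            simp [matMulDirectSum, h2, Ne.symm h2]
          · subst h2
            simp [matMulDirectSum, h1, Ne.symm h1]
          · simp [matMulDirectSum, h1, Ne.symm h1]
        · intro j hj
          have hj' : ya ≠ (j : ℕ) := fun h => hj (Fin.ext h.symm)
          simp [hj']
      · intro i hi
        have hi' : xa ≠ (i : ℕ) := fun h => hi (Fin.ext h.symm)
        simp [hi']
    · -- blocks (1,0,0): `T = -1 + ∑_{ij} [b = a_i] [c = b_j] = 0`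
      subst hxa hya hyb hxc
      simp only [Finset.sum_apply, triad_apply, Fintype.sum_option, Fintype.sum_prod_type,
        Option.elim_none, Option.elim_some]
      rw [Fintype.sum_eq_single (⟨xb, Nat.lt_succ_of_le hxb⟩ : Fin (e' + 1))]
      · rw [Fintype.sum_eq_single (⟨yc, Nat.lt_succ_of_le hyc⟩ : Fin (l' + 1))]
        · simp [matMulDirectSum]
        · intro j hj
          have hj' : yc ≠ (j : ℕ) := fun h => hj (Fin.ext h.symm)
          simp [hj']
      · intro i hi
        have hi' : xb ≠ (i : ℕ) := fun h => hi (Fin.ext h.symm)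
        simp [hi']
    · -- blocks (1,0,1): `T = ∑_j v_{ij}(ν) = 0`
      subst hxa hya hyb hyc
      simp only [Finset.sum_apply, triad_apply, Fintype.sum_option, Fintype.sum_prod_type,
        Option.elim_none, Option.elim_some]
      rw [Fintype.sum_eq_single (⟨xb, Nat.lt_succ_of_le hxb⟩ : Fin (e' + 1))]
      · simp [matMulDirectSum, hS2 xb xc hxc]
      · intro i hi
        have hi' : xb ≠ (i : ℕ) := fun h => hi (Fin.ext h.symm)
        simp [hi']
    · -- blocks (1,1,0): `T = ∑_i u_{ij}(μ) = 0`
      subst hxa hya hxb hxc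
      simp only [Finset.sum_apply, triad_apply, Fintype.sum_option, Fintype.sum_prod_type,
        Option.elim_none, Option.elim_some]
      rw [Finset.sum_comm, Fintype.sum_eq_single (⟨yc, Nat.lt_succ_of_le hyc⟩ : Fin (l' + 1))]
      · simp [matMulDirectSum, hS1 yc yb hyb]
      · intro j hj
        have hj' : yc ≠ (j : ℕ) := fun h => hj (Fin.ext h.symm)
        simp [hj']
    · -- blocks (1,1,1): `T = ∑_{ij} u_{ij}(μ) v_{ij}(ν) = δ_{μν} = ⟨1,h,1⟩`
      subst hxa hya hxb hyc
      simp only [Finset.sum_apply, triad_apply, Fintype.sum_option, Fintype.sum_prod_type,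
        Option.elim_none, Option.elim_some]
      simp [matMulDirectSum, hS3 yb xc hyb hxc]
  · -- rank ≤ e l + 1: `T` is a sum of `|Option (Fin e × Fin l)| = e l + 1` triads
    refine (tensorRank_le_card_of_eq_sum _ _ _ rfl).trans ?_
    simp [Fintype.card_option, Fintype.card_prod, Fintype.card_fin]

end Summit.MatrixMultiplication.MatrixMultiplication.Theorems
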